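import Mathlib
import Literature.Computability.AlgebraicComplexity.FixedPointLog
import Summits.RiemannHypothesis.RiemannHypothesis.Theorems.WeilFormatCJointShiftSOS
import Summits.RiemannHypothesis.RiemannHypothesis.Theorems.WeilFormatCJointShiftCert
import Summits.RiemannHypothesis.RiemannHypothesis.Theorems.WeilFormatCJointShiftCertBrackets
import Summits.RiemannHypothesis.RiemannHypothesis.Theorems.WeilFormatCJointShiftCertSound
import Summits.RiemannHypothesis.RiemannHypothesis.Theorems.WeilFormatCCellShiftCert
import Summits.RiemannHypothesis.RiemannHypothesis.Theorems.WeilFormatCCellShiftCertCells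
import Summits.RiemannHypothesis.RiemannHypothesis.Theorems.WeilFormatCCellShiftCertCorr
import Summits.RiemannHypothesis.RiemannHypothesis.Theorems.WeilFormatCCellShiftCertTable
import HarnessLib

/-!
# Cell-refined shift certificate (route K3): SOUNDNESS of the kernel checker

Helper file (`--supports stmt-RiemannHypothesis-0098`), RH-free; seat rh-explicit-weil-1 gen3.  For a certificate `c`
(`WeilFormatCCellShiftCert.lean`) with `c.check = true` and `c.checkPart j = true` for every `j < c.nparts`:

* `CellSOS.Cert.sound_real` — for every `a ≤ c.aQ` and every real measurable bounded `f` vanishing off `[−a, a]`,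
  **`Σ_{(j,e,·) ∈ witems} 2·(log p_j/√(p_j^e)) · ∫ f(x − e log p_j) f(x) dx ≤ c.D · ∫ f²`**

(the same conclusion as the K2 soundness theorem `JointSOS.Cert.sound_real`, so the bound files and
`WeilFormatC.primeCoeff_form_ge_of_jointShiftBound` consume it unchanged).  Proof: the table of part `j` has value
`W_j + triSum_j` (window classes + upper-triangular pair pass over canonical cell classes); each table is bounded by
`dparts[j]·∫f²` (brackets + `|X| ≤ ∫f²`); summed over the parts, admissible classes vanish (`X_eq_zero_of_adm`), the
window classes re-assemble `I_f = Σ_{k,l} X(·,k,l)` (the pieces tile `f`), and twice the upper triangle equals the full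
Gram double sum (`≥ 0`, `gram_integral_nonneg`) minus the diagonal, which is at most `g0·∫f²` (per-cell masses).
Standard axioms only.
-/

set_option linter.dupNamespace false

noncomputable section

namespace Summit.RiemannHypothesis.RiemannHypothesis.Theorems.WeilFormatC

namespace CellSOS

open MeasureTheory Set Finset JointSOS
open scoped Real BigOperators

namespace Cert

variable {c : Cert} {f : ℝ → ℝ}

/-! ### The full double sum is a Gram form of the shifted pieces -/

section Positivity

variable {C : ℝ}

/-- **Positivity of the full pair sum.** -/
theorem pairSum_nonneg (hcols : c.colsOK c.rank c.mc = true) (hf : Measurable f) (hC : ∀ x, |f x| ≤ C)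
    (hsupp : ∀ x, x ∉ Icc (-(c.aQ : ℝ)) c.aQ → f x = 0) :
    0 ≤ (c.mc.map fun sa ↦ (c.mc.map fun sc ↦ c.fullTerm f sa sc).sum).sum := by
  have hlen := colsOK_spec hcols
  let φ : Fin c.mc.length → ℝ → ℝ := fun α x ↦ c.piece f (c.mc[(α : ℕ)]).2.1 (x - c.toJ.phi (c.mc[(α : ℕ)]).1)
  let R : Fin c.rank → Fin c.mc.length → ℝ :=
    fun i α ↦ (((c.mc[(α : ℕ)]).2.2.getD i 0 : ℤ) : ℝ) / (2 : ℝ) ^ c.kbits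
  have hm : ∀ α, Measurable (φ α) := fun α ↦ (measurable_piece hf _).comp (measurable_id.sub_const _)
  have hb : ∀ α x, |φ α x| ≤ C := fun α x ↦ abs_piece_le hC _ _
  -- the shifted pieces vanish off a common window `[−(aQ + M), aQ + M]`, `M` = max |shift|
  obtain ⟨M, hM⟩ : ∃ M : ℝ, ∀ α : Fin c.mc.length, |c.toJ.phi (c.mc[(α : ℕ)]).1| ≤ M := by
    refine ⟨∑ α : Fin c.mc.length, |c.toJ.phi (c.mc[(α : ℕ)]).1|, fun α ↦ ?_⟩
    exact Finset.single_le_sum (f := fun β : Fin c.mc.length ↦ |c.toJ.phi (c.mc[(β : ℕ)]).1|)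
      (fun _ _ ↦ abs_nonneg _) (Finset.mem_univ α)
  have hs : ∀ α x, x ∉ Icc (-((c.aQ : ℝ) + M)) ((c.aQ : ℝ) + M) → φ α x = 0 := by
    intro α x hx
    apply piece_eq_zero_of hsupp
    intro h
    have h1 := h.1; have h2 := h.2
    have hMα := hM α
    have := abs_le.1 hMα
    exact hx ⟨by linarith, by linarith⟩
  have hpos := gram_integral_nonneg φ hm hb hs R
  rw [JointSOS.Cert.list_double_sum]
  have heq : (∑ α : Fin c.mc.length, ∑ β : Fin c.mc.length, c.fullTerm f (c.mc[(α : ℕ)]) (c.mc[(β : ℕ)])) =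
      ∑ α : Fin c.mc.length, ∑ β : Fin c.mc.length, (∑ i, R i α * R i β) * ∫ x, φ α x * φ β x := by
    refine Finset.sum_congr rfl fun α _ ↦ Finset.sum_congr rfl fun β _ ↦ ?_
    have hα : (c.mc[(α : ℕ)]).2.2.length = c.rank := (hlen _ (List.getElem_mem _)).1
    have hβ : (c.mc[(β : ℕ)]).2.2.length = c.rank := (hlen _ (List.getElem_mem _)).1
    have hdot : (dotZ (c.mc[(α : ℕ)]).2.2 (c.mc[(β : ℕ)]).2.2 : ℝ) / (4 : ℝ) ^ c.kbits =
        ∑ i : Fin c.rank, R i α * R i β := by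
      rw [JointSOS.Cert.dotZ_eq_sum c.rank _ _ hα hβ, Finset.sum_div]
      refine Finset.sum_congr rfl fun i _ ↦ ?_
      simp only [R]
      rw [show ((4 : ℝ)) ^ c.kbits = (2 : ℝ) ^ c.kbits * (2 : ℝ) ^ c.kbits by rw [← mul_pow]; norm_num]
      field_simp
    -- the integral: ∫ f_kα(x − uα) f_lβ(x − uβ) = X(S_β − S_α, lβ, kα)
    have hint : (∫ x, φ α x * φ β x) = c.X f (vsub (c.mc[(β : ℕ)]).1 (c.mc[(α : ℕ)]).1, (c.mc[(β : ℕ)]).2.1,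
        (c.mc[(α : ℕ)]).2.1) := by
      simp only [φ, X]
      rw [integral_shift_mul_shift_eq₂]
      -- X(S_β − S_α, lβ, kα) = ∫ f_lβ(y − (uβ − uα)) f_kα(y) dy; ours is ∫ f_kα(x − (uα − uβ)) f_lβ(x) dx
      have e := X_swap (c := c) f (vsub (c.mc[(β : ℕ)]).1 (c.mc[(α : ℕ)]).1) (c.mc[(β : ℕ)]).2.1 (c.mc[(α : ℕ)]).2.1
      simp only [X] at e
      rw [← e, JointSOS.Cert.phi_vneg, JointSOS.Cert.phi_vsub_swap]
      simp only [neg_neg]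
      congr 1; ext x
      rw [phi_vsub]
    unfold fullTerm
    rw [hdot, hint]
  rw [heq]; exact hpos

end Positivity

/-! ### Re-assembling the window: `I_f = Σ_{k,l} X(·,k,l)` -/

section Assembly

variable {C : ℝ}

/-- A `List.range` sum is a `Finset.range` sum. -/
theorem list_range_sum (F : ℕ → ℝ) : ∀ n : ℕ, ((List.range n).map F).sum = ∑ k ∈ Finset.range n, F k
  | 0 => by simp
  | n + 1 => by
      rw [List.range_succ, List.map_append, List.sum_append, Finset.sum_range_succ, list_range_sum F n]
      simp

/-- **The pieces re-assemble the correlation**: `Σ_{k,l<p} X(γ,k,l) = I_f(γ·ℓ)`. -/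
theorem sum_sum_X (hp : 0 < c.pcells) (hf : Measurable f) (hC : ∀ x, |f x| ≤ C)
    (hsupp : ∀ x, x ∉ Icc (-(c.aQ : ℝ)) c.aQ → f x = 0) (γ : ZVec4) :
    ∑ k ∈ Finset.range c.pcells, ∑ l ∈ Finset.range c.pcells, c.X f (γ, k, l) = ∫ x, f (x - c.toJ.phi γ) * f x := by
  simp only [X]
  have hint : ∀ k l, Integrable fun x ↦ c.piece f k (x - c.toJ.phi γ) * c.piece f l x := by
    intro k l
    simpa using integrable_shift_mul_shift₂ (measurable_piece hf k) (measurable_piece hf l)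
      (abs_piece_le hC k) (abs_piece_le hC l) (piece_eq_zero_of hsupp l) (c.toJ.phi γ) 0
  symm
  calc (∫ x, f (x - c.toJ.phi γ) * f x)
      = ∫ x, ∑ k ∈ Finset.range c.pcells, ∑ l ∈ Finset.range c.pcells,
          c.piece f k (x - c.toJ.phi γ) * c.piece f l x := by
        refine integral_congr_ae (Filter.Eventually.of_forall fun x ↦ ?_)
        simp only
        rw [← sum_piece_eq (c := c) hp hsupp (x - c.toJ.phi γ), ← sum_piece_eq (c := c) hp hsupp x,
          Finset.sum_mul_sum]
    _ = ∑ k ∈ Finset.range c.pcells, ∫ x, ∑ l ∈ Finset.range c.pcells,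
          c.piece f k (x - c.toJ.phi γ) * c.piece f l x :=
        integral_finsetSum _ (fun k _ ↦ integrable_finsetSum _ fun l _ ↦ hint k l)
    _ = _ := Finset.sum_congr rfl fun k _ ↦ integral_finsetSum _ (fun l _ ↦ hint k l)

/-- `Σ_{k<p} ‖f_k‖² = ∫ f²` (as zero-class correlations). -/
theorem sum_X_zero (hp : 0 < c.pcells) (hf : Measurable f) (hC : ∀ x, |f x| ≤ C)
    (hsupp : ∀ x, x ∉ Icc (-(c.aQ : ℝ)) c.aQ → f x = 0) :
    ∑ k ∈ Finset.range c.pcells, c.X f ((0, 0, 0, 0), k, k) = ∫ x, f x ^ 2 := by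
  have h := sum_sum_X hp hf hC hsupp (0, 0, 0, 0)
  rw [JointSOS.Cert.phi_zero, shiftCorr_zero] at h
  rw [← h]
  refine Finset.sum_congr rfl fun k hk ↦ ?_
  rw [Finset.sum_eq_single_of_mem k hk]
  intro l hl hlk
  simp only [X, JointSOS.Cert.phi_zero, sub_zero]
  refine (integral_congr_ae (Filter.Eventually.of_forall fun x ↦ ?_)).trans (integral_zero ℝ ℝ)
  exact piece_mul_piece_eq_zero (Ne.symm hlk) (Finset.mem_range.1 hk) (Finset.mem_range.1 hl) f x

/-- Zero-class correlations are nonnegative: `X(0,k,k) = ∫ f_k² ≥ 0`. -/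
theorem X_zero_nonneg (k : ℕ) : 0 ≤ c.X f ((0, 0, 0, 0), k, k) := by
  simp only [X, JointSOS.Cert.phi_zero, sub_zero]
  exact integral_nonneg fun x ↦ mul_self_nonneg _

/-- Summed over the parts, the window term of `(w, k, l)` is `2·wt(w)·X(e·unit j, k, l)` (admissible ⇒ both `0`). -/
theorem sum_winTerm (hn : 0 < c.nparts)
    (hXadm : ∀ (γ : ZVec4) (k l : ℕ), k < c.pcells → l < c.pcells → c.adm γ k l = true → c.X f (γ, k, l) = 0)
    (w : WItem) {k l : ℕ} (hk : k < c.pcells) (hl : l < c.pcells) :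
    ∑ j ∈ Finset.range c.nparts, c.winTerm f j w (k, l) = 2 * c.toJ.wt w * c.X f (uvec w.1 w.2.1, k, l) := by
  by_cases hadm : c.adm (uvec w.1 w.2.1) k l = true
  · have h0 := hXadm _ _ _ hk hl hadm
    simp only [winTerm, hadm, Bool.not_true, Bool.false_and, Bool.false_eq_true, ↓reduceIte,
      Finset.sum_const_zero, h0, mul_zero]
  · simp only [winTerm, hadm, Bool.not_false, Bool.true_and, decide_eq_true_eq]
    rw [Finset.sum_ite_eq]
    have : c.partOf (uvec w.1 w.2.1, k, l) ∈ Finset.range c.nparts := Finset.mem_range.2 (Nat.mod_lt _ hn)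
    rw [if_pos this]

/-- Summed over the parts, the window value of `w` is `2·wt(w)·I_f(e log p_j)`. -/
theorem sum_winVal (hn : 0 < c.nparts) (hp : 0 < c.pcells) (hf : Measurable f) (hC : ∀ x, |f x| ≤ C)
    (hsupp : ∀ x, x ∉ Icc (-(c.aQ : ℝ)) c.aQ → f x = 0)
    (hXadm : ∀ (γ : ZVec4) (k l : ℕ), k < c.pcells → l < c.pcells → c.adm γ k l = true → c.X f (γ, k, l) = 0)
    (w : WItem) :
    ∑ j ∈ Finset.range c.nparts, c.winVal f j w = 2 * c.toJ.wt w * ∫ x, f (x - c.toJ.phi (uvec w.1 w.2.1)) * f x := by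
  simp only [winVal, list_range_sum]
  calc ∑ j ∈ Finset.range c.nparts, ∑ k ∈ Finset.range c.pcells, ∑ l ∈ Finset.range c.pcells, c.winTerm f j w (k, l)
      = ∑ k ∈ Finset.range c.pcells, ∑ j ∈ Finset.range c.nparts, ∑ l ∈ Finset.range c.pcells, c.winTerm f j w (k, l) :=
        Finset.sum_comm
    _ = ∑ k ∈ Finset.range c.pcells, ∑ l ∈ Finset.range c.pcells, ∑ j ∈ Finset.range c.nparts, c.winTerm f j w (k, l) :=
        Finset.sum_congr rfl fun k _ ↦ Finset.sum_comm
    _ = ∑ k ∈ Finset.range c.pcells, ∑ l ∈ Finset.range c.pcells, 2 * c.toJ.wt w * c.X f (uvec w.1 w.2.1, k, l) :=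
        Finset.sum_congr rfl fun k hk ↦ Finset.sum_congr rfl fun l hl ↦
          sum_winTerm hn hXadm w (Finset.mem_range.1 hk) (Finset.mem_range.1 hl)
    _ = 2 * c.toJ.wt w * ∑ k ∈ Finset.range c.pcells, ∑ l ∈ Finset.range c.pcells, c.X f (uvec w.1 w.2.1, k, l) := by
        simp only [Finset.mul_sum]
    _ = _ := by rw [sum_sum_X hp hf hC hsupp]

end Assembly

/-! ### The main theorem -/

/-- **Soundness of the cell-refined shift certificate (whole-line form, at the certificate's window `aQ`).** -/
theorem sound_real_aQ (c : Cert) (hc : c.check = true) (hparts : ∀ j < c.nparts, c.checkPart j = true)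
    {f : ℝ → ℝ} (hf : Measurable f) {C : ℝ} (hC : ∀ x, |f x| ≤ C)
    (hsupp : ∀ x, x ∉ Icc (-(c.aQ : ℝ)) c.aQ → f x = 0) :
    (c.toJ.witems.map fun w ↦ 2 * (Real.log (c.toJ.pj w.1) / Real.sqrt ((c.toJ.pj w.1 : ℝ) ^ w.2.1)) *
        ∫ x, f (x - (w.2.1 : ℝ) * Real.log (c.toJ.pj w.1)) * f x).sum
      ≤ (c.D : ℝ) * ∫ x, f x ^ 2 := by
  -- unpack the checker
  simp only [check, Bool.and_eq_true, decide_eq_true_eq] at hc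
  obtain ⟨⟨⟨⟨⟨⟨⟨⟨⟨⟨⟨hh, hl⟩, _⟩, hwin⟩, hcols⟩, hden⟩, hn⟩, hp⟩, hlenp⟩, hg0⟩, hmass⟩, hD⟩ := hc
  have hwin' := JointSOS.Cert.windowOK_spec hwin
  have hcells := fun sc h ↦ (colsOK_spec hcols sc h).2
  have hE : 0 ≤ ∫ x, f x ^ 2 := integral_nonneg fun x ↦ sq_nonneg _
  have hXle : ∀ κ : CKey, |c.X f κ| ≤ ∫ x, f x ^ 2 := abs_X_le hf hC hsupp
  have hXadm : ∀ (γ : ZVec4) (k l : ℕ), k < c.pcells → l < c.pcells → c.adm γ k l = true → c.X f (γ, k, l) = 0 :=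
    fun γ k l hk hl' h ↦ X_eq_zero_of_adm f hh hl hden hp hk hl' h
  -- per part: value ≤ claimed bound
  have hpart : ∀ j < c.nparts, c.val f (c.table j) ≤ (c.dparts.getD j 0 : ℝ) * ∫ x, f x ^ 2 := by
    intro j hj
    obtain ⟨hatt, hbd⟩ := tableCheck_spec (hparts j hj)
    rw [zero_add] at hbd
    exact (val_le_tableBound hh hl hXle (c.table j) hatt).trans (mul_le_mul_of_nonneg_right (by exact_mod_cast hbd) hE)
  -- the window part summed over parts and cell pairs
  set W : ℝ := (c.toJ.witems.map fun w ↦ 2 * c.toJ.wt w * ∫ x, f (x - c.toJ.phi (uvec w.1 w.2.1)) * f x).sum with hW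
  have hwin_sum : ∑ j ∈ Finset.range c.nparts, (c.toJ.witems.map (c.winVal f j)).sum = W := by
    rw [JointSOS.Cert.list_sum_finset_sum_comm, hW]
    exact congrArg List.sum (List.map_congr_left fun w _ ↦ sum_winVal hn hp hf hC hsupp hXadm w)
  -- sum of the tables
  have hsum : ∑ j ∈ Finset.range c.nparts, c.val f (c.table j) = W + upper2 c f c.mc := by
    simp only [val_table, Finset.sum_add_distrib]
    rw [hwin_sum, sum_triSum hn hXadm c.mc hcells]
  -- positivity and the diagonal
  have hpos : 0 ≤ diag c f c.mc + upper2 c f c.mc := by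
    rw [diag_add_upper2]; exact pairSum_nonneg hcols hf hC hsupp
  have hdiag : diag c f c.mc ≤ (c.g0 : ℝ) * ∫ x, f x ^ 2 := by
    rw [diag_eq_sum_massOf c.mc hcells, ← sum_X_zero hp hf hC hsupp, Finset.mul_sum]
    refine Finset.sum_le_sum fun k hk ↦ ?_
    have hm : (massOf k c.mc : ℝ) ≤ (c.g0 : ℝ) * (4 : ℝ) ^ c.kbits := by
      have := massOK_spec hmass k (List.mem_range.2 (Finset.mem_range.1 hk))
      exact_mod_cast this
    have h4 : (0 : ℝ) < (4 : ℝ) ^ c.kbits := by positivity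
    refine mul_le_mul_of_nonneg_right ?_ (X_zero_nonneg k)
    rw [div_le_iff₀ h4]; exact hm
  -- Σ dparts + g0 ≤ D
  have hsumD : ∑ j ∈ Finset.range c.nparts, (c.dparts.getD j 0 : ℝ) + (c.g0 : ℝ) ≤ (c.D : ℝ) := by
    have h1 : ∑ j ∈ Finset.range c.nparts, (c.dparts.getD j 0 : ℝ) = ((c.dparts.sum : ℚ) : ℝ) := by
      rw [← hlenp, JointSOS.Cert.sum_range_getD_eq_sum]
    rw [h1, ← JointSOS.Cert.qsum_eq_sum]
    have : ((c.g0 + JointSOS.Cert.qsum c.dparts : ℚ) : ℝ) ≤ (c.D : ℝ) := by exact_mod_cast hD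
    push_cast at this; linarith
  have hle : ∑ j ∈ Finset.range c.nparts, c.val f (c.table j) ≤
      (∑ j ∈ Finset.range c.nparts, (c.dparts.getD j 0 : ℝ)) * ∫ x, f x ^ 2 := by
    rw [Finset.sum_mul]
    exact Finset.sum_le_sum fun j hj ↦ hpart j (Finset.mem_range.1 hj)
  -- the window sum is the target
  have hT : W = (c.toJ.witems.map fun w ↦ 2 * (Real.log (c.toJ.pj w.1) / Real.sqrt ((c.toJ.pj w.1 : ℝ) ^ w.2.1)) *
        ∫ x, f (x - (w.2.1 : ℝ) * Real.log (c.toJ.pj w.1)) * f x).sum := by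
    rw [hW]
    refine congrArg List.sum (List.map_congr_left fun w hw ↦ ?_)
    have hj := (JointSOS.Cert.witemOK_spec (hwin' w hw)).1
    rw [JointSOS.Cert.phi_uvec c.toJ hj]
    simp only [JointSOS.Cert.wt]; push_cast; ring
  rw [← hT]
  have : W = ∑ j ∈ Finset.range c.nparts, c.val f (c.table j) - upper2 c f c.mc := by linarith
  rw [this]
  nlinarith [hle, hpos, hdiag, hsumD, hE, mul_le_mul_of_nonneg_right hsumD hE]

/-- **Soundness of the cell-refined shift certificate (whole-line form)**: if `c.check = true` and every
`c.checkPart j = true` (`j < nparts`), then for every `a ≤ c.aQ` and every real measurable bounded `f` vanishing off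
`[−a, a]`, `Σ_{(j,e) window items} 2·(log p_j/√(p_j^e)) · ∫ f(x − e log p_j) f(x) dx ≤ D · ∫ f²`
(same statement as `JointSOS.Cert.sound_real`). -/
theorem sound_real (c : Cert) (hc : c.check = true) (hparts : ∀ j < c.nparts, c.checkPart j = true)
    {a : ℝ} (ha : a ≤ c.aQ) {f : ℝ → ℝ} (hf : Measurable f) {C : ℝ} (hC : ∀ x, |f x| ≤ C)
    (hsupp : ∀ x, x ∉ Icc (-a) a → f x = 0) :
    (c.toJ.witems.map fun w ↦ 2 * (Real.log (c.toJ.pj w.1) / Real.sqrt ((c.toJ.pj w.1 : ℝ) ^ w.2.1)) *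
        ∫ x, f (x - (w.2.1 : ℝ) * Real.log (c.toJ.pj w.1)) * f x).sum
      ≤ (c.D : ℝ) * ∫ x, f x ^ 2 := by
  refine sound_real_aQ c hc hparts hf hC fun x hx ↦ hsupp x fun h ↦ hx ?_
  exact ⟨by linarith [h.1], by linarith [h.2]⟩


end Cert

end CellSOS

end Summit.RiemannHypothesis.RiemannHypothesis.Theorems.WeilFormatC
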